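import Mathlib
import Summits.Ventures.FusionMHD.Models.CerfonFreidbergIterLikeQHalfMercDefs
import HarnessLib

/-!
# Ventures/FusionMHD — Models/CerfonFreidbergIterLikeQHalfMercPanels6.lean: KERNEL CHECK of the Mercier-register certificates of panel(s) 8, 9 (of 32)
# at `ψ_N = 1/2` of THE Cerfon–Freidberg ITER-like instance

HONEST FRAMING (LADDER-GRIDFUSION three columns; CF rung; «F2.R2-CF-MERCIER-IMPLICIT» step (2), F2-SCOPING v1.6 §10(c)).  One `decide +kernel` (≈ 100 s): for each
listed panel the obligation `CFIterLike.QHalfMerc.MercCert.ok` (`Models/CerfonFreidbergIterLikeQHalfMercDefs.lean`) — the Taylor-model run of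
`progM = progA ++ block1 ++ block2 ++ block3M` over ★ #117's parameter box is ACCEPTED (both `inv` certificates included) and the kernel's FOUR panel-integral
enclosures (`g_W`, `g_Aσ`, `g_AR`, `g_B1` along the approximant) lie inside the claimed integers (read off a compiled `#eval` of the same functions, slack one unit of
`2⁻⁶⁰`; float truth inside every panel, `HOME/models/model-7/g7/genqm/truthM.json`).  MODELLED: analytic Cerfon–Freidberg family; nothing about a device or
stability.  No `native_decide`.  Typer/prover: gridfusion-model-7 (g7), 2026-08-27.
Citations: Jardin 2010 §8.5 (8.134) [Jardin2010]; Mahboubi–Melquiond–Sibut-Pinote 2016 §3.2 Lemma 3 [MahboubiMelquiondSibutpinote2016].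
-/

namespace Summit.Ventures.FusionMHD.Models.CFIterLike.QHalfMerc

/-- Mercier-register certificate data of panel(s) 8, 9. [instance data] -/
def mercCert6 : List MercCert := [
  { j := 8, cand1 := [158496805499783020544, 663520553161065496576, 3039845335214825406464, 10748111537424570515456, 36446900560227727310848, 110102759763644109553664, 303144642662317688881152, 733841255452028776218624, 1859425307017296052486144, 7713767309935848227602432, -1351913904565893196920389632, -8548486300041364998857949184, 1853274126852628212023266639872],
    cand2 := [163362030491347648512, 474634297020178038784, 2206722157749310849024, 8129036416196223696896, 29289677130557091217408, 96200463474945719009280, 297836039902268032548864, 860304725551428998791168, 2721971174019841510080512, 12403997896811170590883840, -1451851073746985808830660608, -10031812237030554226986582016, 2001521569332492975422945886208],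
    deg := 10, e1 := 42, e2 := 42, wlo := -762091781099365603, whi := -762091654484836656, slo := 5548942597174041839, shi := 5548942922197146376,
    rlo := 8057374611740152941, rhi := 8057375095666085130, blo := 3821542430303945611, bhi := 3821542652386328322 },
  { j := 9, cand1 := [182566773043458637824, 890032960413561520128, 4299475765893267980288, 16591430553058200780800, 58983815000806788169728, 184804149041724154445824, 509424998792220213510144, 1163414803447365417041920, 1832405513995110972391424, 8194942457563793552572416, -18707976770991115508645888, -11831022624346556286566924288, 12278856055515262892552224768],
    cand2 := [180628537485491830784, 640463562962585780224, 3174664288479360319488, 12944653307133489577984, 49784143445305258409984, 174482752673745779818496, 567223950343869558685696, 1690866906403286103883776, 4507117111981026404466688, 17559027933427868947709952, 100851483384507381980332032, -9366709626352582381281476608, -42407801263115446008353390592],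
    deg := 10, e1 := 43, e2 := 42, wlo := -887425985986584589, whi := -887425810842857878, slo := 6278262947984218166, shi := 6278263281823509341,
    rlo := 8936547292522786190, rhi := 8936547780782096015, blo := 4410892173009949278, bhi := 4410892406035779097 }]

/-- **KERNEL CHECK** of the four Mercier registers on panel(s) 8, 9. -/
theorem mercCert6_ok : CFIterLike.QHalfMerc.mercCert6.all MercCert.ok = true := by
  decide +kernel

end Summit.Ventures.FusionMHD.Models.CFIterLike.QHalfMerc
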